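import Summits.BirchSwinnertonDyer.Rank1Residual.Additive.BranchPAdicGrossZagierUpperHalf
import Summits.BirchSwinnertonDyer.Rank1Residual.Supersingular.JetchevIndexSqueeze
import HarnessLib

/-!
# (S11) SHA-squared rank-ONE class corollaries by first-descent COUNT: `BSD(E,p)` on the X4♯(G-ord) /
# X4(M) rows with `ord_p #Ш_an(E) ≤ 2` from the hna-FREE UPPER half + Cassels–Tate + ONE certificate
# `p² ∣ #Sel^(p)(E/ℚ)` (cell `b2b-bsdres`, team n1011, seat p16 GEN 5; row T-S11 = route planner 3's
# sub-target (S11), `cells/n1011/ROUTE-3.md` l.103 (S11-a), (S11-a₃), (S11-b); lead R5-56 deal)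

HONEST FRAMING (cell `b2b-bsdres`, run/shared/lean/b2b/bsd-rank1-residual/, verbatim in every
file): the goal of the cell is to DELETE the COMBINATION-SHAPED residual classes of the
Birch–Swinnerton-Dyer formula for ALL analytic-rank `≤ 1` elliptic curves over `ℚ` — "full BSD
formula for every rank `≤ 1` curve in class `C`" assembled STRICTLY from published theorems — so
that the rank-`≤ 1` remainder becomes exactly the CONSTRUCTION-SHAPED classes, which are TYPED
(missing-input `Prop`s), NOT attempted. This is not "finishing BSD". Team n1011 (N10 / N11 / O7),
seat p16: research route; X4 stays CONSTRUCTION-SHAPED; the N10 / N11 / O7 marks are UNCHANGED by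
this file; it closes NO class; nothing is booked here; no Literature fact is minted.

Theorems only (no `def`, no `sorry`, no new named fact); each corollary is ONE term over landed names.
The rank-ONE twin of (S10) (`RankOneUpperHalfUnitRows`, unit literal `ord_p q = 0`) on the rows where
`p ∣ #Ш_an(E)`: the unit literal is REPLACED by `hv : ord_p q ≤ 2`, the PUBLISHED Cassels–Tate
pairing (`hCT : exists_casselsTate_pairing`, Silverman *AEC* X.4.14, exactly as in x10b's
`Supersingular.X6.bsdp_of_casselsTate_of_pow_succ_dvd_card_selmerGroup` and additive-p3's
`Supersingular.bsdp_of_missingUpperBoundAt_of_casselsTate_of_card_selmerGroup`, p273823) and ONE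
certificate literal per pair, the first-descent COUNT `hcard : p ^ 2 ∣ #Sel^(p)(E/ℚ)` (an x-lane
`p`-descent record exhibiting two independent exact Selmer elements — a LOWER bound, mode-neutral;
EVIDENCE when instantiated; lead R5-54 (e)). Mechanism (all BY NAME):
`p ∤ #E(ℚ)_tors` from `Irr` (x10b's `Supersingular.not_dvd_torsionOrder_of_irr`), so
`p^{r_an+1} = p² ∣ #Sel^(p)` forces `Ш[p] ≠ 0`, Cassels–Tate gives `p² ∣ #Ш` — the LOWER
`MissingLowerBoundAt` at `ord_p #Ш_an ≤ 2`; the UPPER `MissingUpperBoundAt` is seat p01's hna-free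
rank-one half (`ClassX4Gord.missingUpperBoundAt_rankOne_of_katoHalf_of_branchPAdicGrossZagierOdd` over
Kato's half-eigen reading, `ClassX4M.…Mult` on the (M) rows); Miller's `BSD(E,p)` follows
(`Typed.bsdp_of_missingPPartAt`). The typed UPPER inputs — (B)-datum `hB`, Schneider rider `hS`, the
row's branch `p`-adic Gross–Zagier `hGZ` — are EXACTLY as open as on the unit rows.

* `ClassX4Gord.bsdp_rankOne_of_katoHalf_of_branchPAdicGrossZagierOdd_of_casselsTate_of_sq_dvd_card_selmerGroup`
  — (S11-a): X4♯(G-ord, `e = 2`) ∧ surj, `p ≡ 3 (mod 4)` (incl. `3`), `r_an = 1`;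
* `ClassX4Gord.bsdp_three_rankOne_of_katoHalf_of_branchPAdicGrossZagierOdd_of_casselsTate_of_sq_dvd_card_selmerGroup`
  — (S11-a₃): `p = 3`, `e = 2` and `3 ≡ 3 (mod 4)` discharged;
* `ClassX4M.bsdp_rankOne_of_katoHalf_of_branchPAdicGrossZagierMult_of_casselsTate_of_sq_dvd_card_selmerGroup`
  — (S11-b): X4(M) ∧ surj, every odd `p`, `r_an = 1`; and its `p = 3` reading
  `ClassX4M.bsdp_three_rankOne_…_of_sq_dvd_card_selmerGroup`.

Route planner 3's sizing (ROUTE-3 l.76 / l.102–103, zero compute, EVIDENCE): at `p = 3`, `N < 5·10⁵`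
the O7-ord ∩ X4@3 rank-one `surj ∧ tower` rows with `3 ∣ #Ш_an` are 40 classes (Gord3 12, M 28),
every one with `ord₃ #Ш_an = 2` exactly, so `hv` holds on all 40. The certificate `hcard` is a LOWER
bound on `#Sel^(3)(E/ℚ)`, hence mode-neutral: it is certified per pair by two independent EXHIBITED exact
3-Selmer elements (x11b/x11c `desc3lib`, either mode — every listed Selmer element is exact, so `dim ≥`
is unconditional; ROUTE-3 l.106); in hand today for 2/40 — 90459m1, 117648y1 (x11c GEN 15,
`dim_𝔽₃ Sel^(3) = 3` EXACT) — the other 38 get it from any descent run exhibiting two elements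
(per-pair x-lane records, lead R5-54 (e); nothing is commissioned here).
References: [Kato2004Asterisque] Thm. 17.4; [Delbourgo2002] Thm. (B); [SilvermanAEC2009] Thm. X.4.14
(Cassels–Tate); [Miller2011LMS] Def. 1.1.
-/

noncomputable section

open scoped Classical MatrixGroups ModularForm NumberField

open CongruenceSubgroup WeierstrassCurve NumberField Literature.NumberTheory.EllipticCurves
  Literature.NumberTheory.EllipticCurves.ModularForms
  Literature.NumberTheory.EllipticCurves.Rank1Residual
  Literature.NumberTheory.EllipticCurves.Rank1Residual.Typed
  Literature.NumberTheory.EllipticCurves.Delbourgo2002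

namespace Summit.BirchSwinnertonDyer.Rank1Residual.Additive

open Supersingular

variable {W : WeierstrassCurve ℚ} [W.IsElliptic] [W.IsGloballyMinimal] {p : ℕ} [Fact p.Prime]

/-- **(S11-a) X4♯(G-ord, `e = 2`) ∧ surj, `r_an = 1`, `p ≡ 3 (mod 4)` (incl. `p = 3`), `ord_p #Ш_an(E) ≤ 2`,
certificate `p² ∣ #Sel^(p)(E/ℚ)`: `BSD(E,p)`** — the hna-free UPPER half (seat p01: Kato's half-eigen reading
`hK` + (B)-datum `hB` + rider `hS` + the typed odd-branch `p`-adic Gross–Zagier `hGZ`) squeezed against the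
LOWER from Cassels–Tate (`hCT`) and the first-descent count (`hcard`; `p ∤ #E(ℚ)_tors` from `Irr`), through
additive-p3's half-closed shape `Supersingular.bsdp_of_missingUpperBoundAt_of_casselsTate_of_card_selmerGroup`.
Closes no class; `hq`, `hv`, `hcard` are per-row LITERALS (EVIDENCE when instantiated).
[cite: Kato2004Asterisque, Thm. 17.4] [cite: Delbourgo2002, Theorem (B) (p. 40)]
[cite: SilvermanAEC2009, Thm. X.4.14] [cite: Miller2011LMS, Def. 1.1] -/
theorem ClassX4Gord.bsdp_rankOne_of_katoHalf_of_branchPAdicGrossZagierOdd_of_casselsTate_of_sq_dvd_card_selmerGroup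
    (hK : Wuthrich2014.kato_halfEigenCharIdeal_dvd_cyclotomicPrime_of_surjective)
    (hCT : exists_casselsTate_pairing (K := ℚ))
    (hGZK : rank_eq_analyticRank_of_analyticRank_le_one) (hmod : hasEntireLFunction_rat)
    (hmodD : nonempty_modularParametrizationData) (hX : ClassX4Gord W p)
    (he : semistabilityIndex W p = 2) (hp4 : p % 4 = 3) (hsurj : Surj W p) (hr : W.analyticRank = 1)
    {Dh : PAdicHeightData W p} (hB : LeadingTermClauses W p Dh) (hS : SchneiderConjecture Dh)
    (hGZ : BranchPAdicGrossZagierOddAt W p Dh) {q : ℚ} (hq : shaAn W = (q : ℂ))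
    (hv : padicValRat p q ≤ 2) (hcard : p ^ 2 ∣ Nat.card (W.selmerGroup (p : ℤ))) :
    BSDp W p :=
  bsdp_of_missingUpperBoundAt_of_casselsTate_of_card_selmerGroup W p hCT hGZK (by rw [hr])
    (not_dvd_torsionOrder_of_irr W p hX.1.2.2) hq hv (by rw [hr]; exact hcard)
    (ClassX4Gord.missingUpperBoundAt_rankOne_of_katoHalf_of_branchPAdicGrossZagierOdd hK hGZK hmod hmodD hX
      he hp4 hsurj hr hB hS hGZ)

/-- **(S11-a₃) At `p = 3`** (N11's grade; `e = 2` automatic for type (G) at `3`,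
`semistabilityIndex_eq_two_of_typeG_three`; `3 ≡ 3 (mod 4)`): X4♯(G-ord)@3 ∧ surj(3), `r_an = 1`,
`ord₃ #Ш_an(E) ≤ 2`, certificate `9 ∣ #Sel^(3)(E/ℚ)` (two independent exact 3-Selmer elements exhibited
per pair, mode-neutral) ⟹ `BSD(E,3)`. Route planner 3's SHA3 cell: 12 Gord3 rows (`N < 5·10⁵`), certificate
in hand for 90459m1 (x11c GEN 15, `dim_𝔽₃ Sel^(3) = 3` EXACT).
[cite: Kato2004Asterisque, Thm. 17.4] [cite: Delbourgo2002, Theorem (B) (p. 40)]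
[cite: SilvermanAEC2009, Thm. X.4.14] [cite: Miller2011LMS, Def. 1.1] -/
theorem ClassX4Gord.bsdp_three_rankOne_of_katoHalf_of_branchPAdicGrossZagierOdd_of_casselsTate_of_sq_dvd_card_selmerGroup
    {W : WeierstrassCurve ℚ} [W.IsElliptic] [W.IsGloballyMinimal] [Fact (Nat.Prime 3)]
    (hK : Wuthrich2014.kato_halfEigenCharIdeal_dvd_cyclotomicPrime_of_surjective)
    (hCT : exists_casselsTate_pairing (K := ℚ))
    (hGZK : rank_eq_analyticRank_of_analyticRank_le_one) (hmod : hasEntireLFunction_rat)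
    (hmodD : nonempty_modularParametrizationData) (hX : ClassX4Gord W 3) (hsurj : Surj W 3)
    (hr : W.analyticRank = 1) {Dh : PAdicHeightData W 3} (hB : LeadingTermClauses W 3 Dh)
    (hS : SchneiderConjecture Dh) (hGZ : BranchPAdicGrossZagierOddAt W 3 Dh)
    {q : ℚ} (hq : shaAn W = (q : ℂ)) (hv : padicValRat 3 q ≤ 2)
    (hcard : 3 ^ 2 ∣ Nat.card (W.selmerGroup (3 : ℤ))) : BSDp W 3 :=
  ClassX4Gord.bsdp_rankOne_of_katoHalf_of_branchPAdicGrossZagierOdd_of_casselsTate_of_sq_dvd_card_selmerGroup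
    hK hCT hGZK hmod hmodD hX (semistabilityIndex_eq_two_of_typeG_three W hX.typeGOrd.typeG hX.addv.2)
    (by norm_num) hsurj hr hB hS hGZ hq hv (by exact_mod_cast hcard)

end Summit.BirchSwinnertonDyer.Rank1Residual.Additive

namespace Summit.BirchSwinnertonDyer.Rank1Residual.AdditivePotMult

open Additive Supersingular

variable {W : WeierstrassCurve ℚ} [W.IsElliptic] [W.IsGloballyMinimal] {p : ℕ} [Fact p.Prime]

/-- **(S11-b) X4(M) ∧ surj, every odd `p`, `r_an = 1`, `ord_p #Ш_an(E) ≤ 2`, certificate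
`p² ∣ #Sel^(p)(E/ℚ)`: `BSD(E,p)`** — the hna-free UPPER half on the (M) rows (seat p01:
`ClassX4M.missingUpperBoundAt_rankOne_of_katoHalf_of_branchPAdicGrossZagierMult` over Kato's half `hK`,
(B)-datum `hB`, rider `hS`, typed `hGZ : BranchPAdicGrossZagierMultAt`) squeezed against Cassels–Tate +
the first-descent count (`p ∤ #E(ℚ)_tors` from `ClassX4M.irr`). Closes no class; literals per row.
[cite: Kato2004Asterisque, Thm. 17.4] [cite: Delbourgo2002, Theorem (B) (p. 40)]
[cite: SilvermanAEC2009, Thm. X.4.14] [cite: Miller2011LMS, Def. 1.1] -/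
theorem ClassX4M.bsdp_rankOne_of_katoHalf_of_branchPAdicGrossZagierMult_of_casselsTate_of_sq_dvd_card_selmerGroup
    (hK : Wuthrich2014.kato_halfEigenCharIdeal_dvd_cyclotomicPrime_of_surjective)
    (hCT : exists_casselsTate_pairing (K := ℚ))
    (hGZK : rank_eq_analyticRank_of_analyticRank_le_one) (hmod : hasEntireLFunction_rat)
    (hmodD : nonempty_modularParametrizationData) (hX : ClassX4M W p) (hsurj : Surj W p)
    (hr : W.analyticRank = 1)
    {Dh : PAdicHeightData W p} (hB : LeadingTermClauses W p Dh) (hS : SchneiderConjecture Dh)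
    (hGZ : BranchPAdicGrossZagierMultAt W p Dh) {q : ℚ} (hq : shaAn W = (q : ℂ))
    (hv : padicValRat p q ≤ 2) (hcard : p ^ 2 ∣ Nat.card (W.selmerGroup (p : ℤ))) :
    BSDp W p :=
  bsdp_of_missingUpperBoundAt_of_casselsTate_of_card_selmerGroup W p hCT hGZK (by rw [hr])
    (not_dvd_torsionOrder_of_irr W p (ClassX4M.irr W p hX)) hq hv (by rw [hr]; exact hcard)
    (ClassX4M.missingUpperBoundAt_rankOne_of_katoHalf_of_branchPAdicGrossZagierMult hK hGZK hmod hmodD hX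
      hsurj hr hB hS hGZ)

/-- **(S11-b) at `p = 3`** (N11's grade): X4(M)@3 ∧ surj(3), `r_an = 1`, `ord₃ #Ш_an(E) ≤ 2`, certificate
`9 ∣ #Sel^(3)(E/ℚ)` (two independent exact 3-Selmer elements exhibited per pair, mode-neutral) ⟹ `BSD(E,3)`.
Route planner 3's SHA3 cell: 28 (M) rows (`N < 5·10⁵`), certificate in hand for 117648y1 (x11c GEN 15,
`dim_𝔽₃ Sel^(3) = 3` EXACT). [cite: Kato2004Asterisque, Thm. 17.4]
[cite: Delbourgo2002, Theorem (B) (p. 40)] [cite: SilvermanAEC2009, Thm. X.4.14] [cite: Miller2011LMS, Def. 1.1] -/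
theorem ClassX4M.bsdp_three_rankOne_of_katoHalf_of_branchPAdicGrossZagierMult_of_casselsTate_of_sq_dvd_card_selmerGroup
    {W : WeierstrassCurve ℚ} [W.IsElliptic] [W.IsGloballyMinimal] [Fact (Nat.Prime 3)]
    (hK : Wuthrich2014.kato_halfEigenCharIdeal_dvd_cyclotomicPrime_of_surjective)
    (hCT : exists_casselsTate_pairing (K := ℚ))
    (hGZK : rank_eq_analyticRank_of_analyticRank_le_one) (hmod : hasEntireLFunction_rat)
    (hmodD : nonempty_modularParametrizationData) (hX : ClassX4M W 3) (hsurj : Surj W 3)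
    (hr : W.analyticRank = 1) {Dh : PAdicHeightData W 3} (hB : LeadingTermClauses W 3 Dh)
    (hS : SchneiderConjecture Dh) (hGZ : BranchPAdicGrossZagierMultAt W 3 Dh)
    {q : ℚ} (hq : shaAn W = (q : ℂ)) (hv : padicValRat 3 q ≤ 2)
    (hcard : 3 ^ 2 ∣ Nat.card (W.selmerGroup (3 : ℤ))) : BSDp W 3 :=
  ClassX4M.bsdp_rankOne_of_katoHalf_of_branchPAdicGrossZagierMult_of_casselsTate_of_sq_dvd_card_selmerGroup
    hK hCT hGZK hmod hmodD hX hsurj hr hB hS hGZ hq hv (by exact_mod_cast hcard)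

end Summit.BirchSwinnertonDyer.Rank1Residual.AdditivePotMult

end
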